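import Summits.ABC.ABC.Theses.FeketeScales
import Summits.ABC.ABC.Theorems.PrimePowerRadical.Negative.NonWieferich
import Summits.ABC.ABC.Theorems.PrimePowerRadical.Negative.Orders
import Literature.NumberTheory.DiophantineGeometry.AbcPrimePowerFamily
import HarnessLib

/-!
# Route FeketeScales — crux `SparseGoodScales` (stmt-ABC-2161): the Wieferich floor, QUANTIFIED

Helper file (`--supports stmt-ABC-2161`, lead seat c5) for the crux `SparseGoodScales` of route
`FeketeScales`.  `FeketeScalesSparseGoodScalesWieferich.lean` (p99695) proved the qualitative floor
"good scales at one exponent `1 + δ < 2` force infinitely many non-Wieferich primes to every prime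
base".  This file proves the quantitative statement behind it, scale by scale and with explicit
constants:

* `sparseGoodScales_rpow_lt_nonWieferich_prod_of_goodScale` — **at every `(1+δ)`-good scale `R ≥ 1`
  and for every prime `q`, the odd non-Wieferich primes `p ≤ q·⌊R^{1+δ}⌋` to base `q` have product
  `> R^{1−δ} / (4 q³)`** (as reals: `R^{1−δ} < 4 q³ · ∏ p`);
* `sparseGoodScales_log_lt_nonWieferich_mass_of_goodScale` — the same in logarithmic mass:
  `(1 − δ) log R < log (4 q³) + Σ log p`;
* `sparseGoodScales_imp_nonWieferich_mass` — hence the crux forces, for every prime `q`, every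
  `δ > 0` and every `N`, a scale `R ≥ N` below which (`p ≤ q R^{1+δ}`) the non-Wieferich primes to
  base `q` have logarithmic mass `> (1 − δ) log R − log (4q³)`.

So any proof of stmt-ABC-2161 must PRODUCE non-Wieferich primes of total logarithmic mass
`(1 − δ − o(1)) log R` below `q R^{1+δ}` at infinitely many scales `R` — compare Silverman's
abc-conditional `#{p ≤ X non-Wieferich} ≫_q log X` at ALL `X` (J. Number Theory 30 (1988), Thm 1); the
qualitative floor of p99695 is the special case "the set is not finite" (a finite set has bounded
product, while `R^{1−δ} → ∞` for `δ < 1`).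

Mechanism.  For `n = q^k − 1` split the odd prime factors into Wieferich ones (level `≥ 2`, so `p² ∣ n`
by the exact valuation `v_p(q^k − 1) = W_p(q) + v_p(k)`, `padicValNat_family`) and non-Wieferich ones
(product `N_k`): `∏_{p odd ∣ n} p^{e_p} ∣ n` with `e_p ∈ {2, 1}` gives `rad(n)² ≤ 4 n N_k`.  At a good
scale `R` take `k` minimal with `q^k > R^{1+δ}`: the triple `(1, q^k − 1, q^k)` violates `c ≤ R^{1+δ}`, so
its radical `q · rad(q^k − 1)` exceeds `R`, whence `R² < q² · 4 q^k N_k ≤ 4 q³ R^{1+δ} N_k`.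
-/

noncomputable section

namespace Summit.ABC.ABC.Theorems

open Literature.NumberTheory.DiophantineGeometry UniqueFactorizationMonoid
open Summit.ABC.ABC.Theses.FeketeScales
open Summit.ABC.ABC.Theorems.PrimePowerRadical.Negative
open scoped Classical

/-! ## The radical of `q^k − 1` against its non-Wieferich part -/

/-- `rad(n) ≤ 2 · ∏_{p ∣ n, p odd prime} p`. [folklore] -/
theorem sparseGoodScales_radical_le_two_mul_prod_odd (n : ℕ) :
    radical n ≤ 2 * ∏ p ∈ n.primeFactors.erase 2, p := by
  rw [Nat.radical_eq_prod_primeFactors]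
  have hpos : 0 < ∏ p ∈ n.primeFactors.erase 2, p :=
    Finset.prod_pos fun p hp => (Nat.prime_of_mem_primeFactors (Finset.mem_of_mem_erase hp)).pos
  by_cases h2 : 2 ∈ n.primeFactors
  · rw [← Finset.mul_prod_erase _ _ h2]
  · rw [Finset.erase_eq_of_notMem h2]; omega

/-- **`rad(q^k − 1)² ≤ 4 (q^k − 1) · N_k`**, where `N_k` is the product of the odd NON-Wieferich prime
factors of `q^k − 1` (prime `q`, `k ≥ 1`): every odd Wieferich prime factor occurs squared
(`v_p(q^k − 1) = W_p(q) + v_p(k) ≥ 2`). [folklore] -/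
theorem sparseGoodScales_radical_sq_le {q k : ℕ} (hq : q.Prime) (hk : 1 ≤ k) :
    radical (q ^ k - 1) ^ 2 ≤ 4 * (q ^ k - 1) *
      ∏ p ∈ ((q ^ k - 1).primeFactors.erase 2).filter (fun p => ¬ IsWieferich q p), p := by
  set n : ℕ := q ^ k - 1 with hn
  have hn0 : n ≠ 0 := by have := two_le_pow_of_two_le hq.two_le hk; omega
  set S : Finset ℕ := n.primeFactors.erase 2 with hS
  have hSp : ∀ r ∈ S, r.Prime := fun r hr => Nat.prime_of_mem_primeFactors (Finset.mem_of_mem_erase hr)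
  -- exponents: 2 on Wieferich primes, 1 on the others
  set e : ℕ → ℕ := fun p => if IsWieferich q p then 2 else 1 with he
  have hdvd : ∏ r ∈ S, r ^ e r ∣ n := by
    refine prod_prime_pow_dvd_of_forall_dvd hSp e hn0 (fun r hr => ?_)
    obtain ⟨hr2, hrF⟩ := Finset.mem_erase.mp hr
    have hrp : r.Prime := Nat.prime_of_mem_primeFactors hrF
    have hrn : r ∣ n := Nat.dvd_of_mem_primeFactors hrF
    by_cases hW : IsWieferich q r
    · -- `r² ∣ n`
      haveI := Fact.mk hrp
      have hrq : ¬ r ∣ q := not_dvd_base_of_dvd hrp hk hq.one_lt.le hrn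
      have h2 : 2 ≤ padicValNat r n := by
        rw [hn, padicValNat_family hq.two_le hrp hr2 hk hrn]
        have := (isWieferich_iff_two_le_wieferichLevel hq.two_le hrp hr2 hrq).mp hW
        omega
      simp only [he, if_pos hW]
      exact (padicValNat_dvd_iff_le hn0).mpr h2
    · simp only [he, if_neg hW, pow_one]; exact hrn
  have hle : ∏ r ∈ S, r ^ e r ≤ n := Nat.le_of_dvd (Nat.pos_of_ne_zero hn0) hdvd
  -- `(∏_S r)² = (∏_S r^{e r}) · N`
  have hsq : (∏ r ∈ S, r) ^ 2 = (∏ r ∈ S, r ^ e r) * ∏ r ∈ S.filter (fun p => ¬ IsWieferich q p), r := by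
    rw [Finset.prod_filter, ← Finset.prod_pow, ← Finset.prod_mul_distrib]
    refine Finset.prod_congr rfl (fun r _ => ?_)
    by_cases hW : IsWieferich q r
    · simp [he, hW]
    · simp [he, hW, pow_two]
  have hrad : radical n ≤ 2 * ∏ r ∈ S, r := sparseGoodScales_radical_le_two_mul_prod_odd n
  calc radical n ^ 2 ≤ (2 * ∏ r ∈ S, r) ^ 2 := Nat.pow_le_pow_left hrad 2
    _ = 4 * ((∏ r ∈ S, r ^ e r) * ∏ r ∈ S.filter (fun p => ¬ IsWieferich q p), r) := by
        rw [mul_pow, hsq]; norm_num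
    _ ≤ 4 * (n * ∏ r ∈ S.filter (fun p => ¬ IsWieferich q p), r) := by
        exact Nat.mul_le_mul_left 4 (Nat.mul_le_mul_right _ hle)
    _ = 4 * n * ∏ r ∈ S.filter (fun p => ¬ IsWieferich q p), r := by ring

/-! ## The quantitative floor at one good scale -/

/-- **THE WIEFERICH FLOOR, QUANTIFIED.**  If `R ≥ 1` is a `(1+δ)`-good scale (every abc triple of
radical `≤ R` has `c ≤ R^{1+δ}`; `δ ≥ −1`), then for every prime `q` the odd non-Wieferich primes `p`
to base `q` with `p ≤ q · ⌊R^{1+δ}⌋` have product `> R^{1−δ}/(4q³)`.  Proof: `k` minimal with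
`q^k > R^{1+δ}`; the triple `(1, q^k − 1, q^k)` is too high for the good scale, so
`R < q · rad(q^k − 1)`, and `rad(q^k − 1)² ≤ 4 q^k N_k ≤ 4 q R^{1+δ} N_k`
(`sparseGoodScales_radical_sq_le`), the primes of `N_k` being `< q^k ≤ q ⌊R^{1+δ}⌋`.
[cite: Silverman1988, Thm 1] -/
theorem sparseGoodScales_rpow_lt_nonWieferich_prod_of_goodScale {q : ℕ} (hq : q.Prime) {δ : ℝ}
    (hδ : -1 ≤ δ) {R : ℕ} (hR : 1 ≤ R)
    (hgood : ∀ a b c : ℕ, IsABCTriple a b c → rad a b c ≤ R → (c : ℝ) ≤ (R : ℝ) ^ (1 + δ)) :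
    (R : ℝ) ^ (1 - δ) < 4 * (q : ℝ) ^ 3 *
      ∏ p ∈ (Finset.range (q * ⌊(R : ℝ) ^ (1 + δ)⌋₊ + 1)).filter
        (fun p => p.Prime ∧ p ≠ 2 ∧ ¬ IsWieferich q p), (p : ℝ) := by
  have hq2 : 2 ≤ q := hq.two_le
  have hR1 : (1 : ℝ) ≤ R := by exact_mod_cast hR
  have hR0 : (0 : ℝ) < R := by linarith
  set X : ℝ := (R : ℝ) ^ (1 + δ) with hX
  have hX1 : 1 ≤ X := Real.one_le_rpow hR1 (by linarith)
  -- `k` minimal with `X < q^k`; then `k ≥ 1` and `q^k ≤ q X`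
  have hex : ∃ k : ℕ, X < (q : ℝ) ^ k := pow_unbounded_of_one_lt X (by exact_mod_cast hq.one_lt)
  set k := Nat.find hex with hk
  have hkX : X < (q : ℝ) ^ k := Nat.find_spec hex
  have hk1 : 1 ≤ k := by
    by_contra h
    have h0 : k = 0 := by omega
    rw [h0, pow_zero] at hkX
    linarith
  have hkm : (q : ℝ) ^ (k - 1) ≤ X := not_lt.mp (Nat.find_min hex (show k - 1 < k by omega))
  have hpow : (q : ℝ) ^ k = q * (q : ℝ) ^ (k - 1) := by
    conv_lhs => rw [show k = (k - 1) + 1 by omega, pow_succ]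
    ring
  have hqk : (q : ℝ) ^ k ≤ q * X := by
    rw [hpow]; exact mul_le_mul_of_nonneg_left hkm (by positivity)
  -- the triple `(1, q^k − 1, q^k)` is too high for the good scale, so its radical exceeds `R`
  have hrad_gt : R < radical (q ^ k - 1) * q := by
    rw [← rad_one_pow_sub_one_pow hq hk1]
    by_contra h
    push Not at h
    have := hgood _ _ _ (isABCTriple_one_pow_sub_one hq2 hk1) h
    push_cast at this
    linarith
  -- the non-Wieferich part `N` of `q^k − 1` and the ambient product `W`
  set N : ℕ := ∏ p ∈ ((q ^ k - 1).primeFactors.erase 2).filter (fun p => ¬ IsWieferich q p), p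
    with hN
  set W : ℕ := ∏ p ∈ (Finset.range (q * ⌊X⌋₊ + 1)).filter
    (fun p => p.Prime ∧ p ≠ 2 ∧ ¬ IsWieferich q p), p with hW
  have hsq : radical (q ^ k - 1) ^ 2 ≤ 4 * q ^ k * N :=
    le_trans (sparseGoodScales_radical_sq_le hq hk1)
      (Nat.mul_le_mul_right N (Nat.mul_le_mul_left 4 (Nat.sub_le _ _)))
  have hNW : N ≤ W := by
    apply Finset.prod_le_prod_of_subset_of_one_le'
    · intro p hp
      simp only [Finset.mem_filter, Finset.mem_erase, Finset.mem_range] at hp ⊢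
      obtain ⟨⟨hp2, hpF⟩, hpW⟩ := hp
      have hpp : p.Prime := Nat.prime_of_mem_primeFactors hpF
      have hpdvd : p ∣ q ^ k - 1 := Nat.dvd_of_mem_primeFactors hpF
      refine ⟨?_, hpp, hp2, hpW⟩
      have h1 : p ≤ q ^ k - 1 :=
        Nat.le_of_dvd (by have := two_le_pow_of_two_le hq2 hk1; omega) hpdvd
      have h2 : q ^ (k - 1) ≤ ⌊X⌋₊ := Nat.le_floor (by exact_mod_cast hkm)
      have h3 : q ^ k = q * q ^ (k - 1) := by
        conv_lhs => rw [show k = (k - 1) + 1 by omega, pow_succ]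
        ring
      have h4 : q ^ k ≤ q * ⌊X⌋₊ := by rw [h3]; exact Nat.mul_le_mul_left q h2
      omega
    · intro p hp _
      exact (Finset.mem_filter.mp hp).2.1.one_le
  -- combine: `R² < q² rad² ≤ 4 q² q^k N ≤ 4 q³ X W`
  have h1 : (R : ℝ) ^ 2 < (q : ℝ) ^ 2 * ((radical (q ^ k - 1) : ℕ) : ℝ) ^ 2 := by
    have h : (R : ℝ) < ((radical (q ^ k - 1) : ℕ) : ℝ) * q := by exact_mod_cast hrad_gt
    have h' : (0 : ℝ) ≤ ((radical (q ^ k - 1) : ℕ) : ℝ) * q := by positivity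
    nlinarith
  have h2 : ((radical (q ^ k - 1) : ℕ) : ℝ) ^ 2 ≤ 4 * (q : ℝ) ^ k * N := by exact_mod_cast hsq
  have h3 : (N : ℝ) ≤ W := by exact_mod_cast hNW
  have hN0 : (0 : ℝ) ≤ N := by positivity
  have h4 : (R : ℝ) ^ 2 < 4 * (q : ℝ) ^ 3 * X * W := by
    calc (R : ℝ) ^ 2 < (q : ℝ) ^ 2 * ((radical (q ^ k - 1) : ℕ) : ℝ) ^ 2 := h1
      _ ≤ (q : ℝ) ^ 2 * (4 * (q : ℝ) ^ k * N) := by gcongr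
      _ ≤ (q : ℝ) ^ 2 * (4 * (q * X) * N) := by gcongr
      _ ≤ (q : ℝ) ^ 2 * (4 * (q * X) * W) := by gcongr
      _ = 4 * (q : ℝ) ^ 3 * X * W := by ring
  -- `R^{1−δ} · X = R²`
  have hsplit : (R : ℝ) ^ (1 - δ) * X = (R : ℝ) ^ 2 := by
    rw [hX, ← Real.rpow_add hR0, show (1 - δ) + (1 + δ) = (2 : ℝ) by ring, Real.rpow_two]
  have hX0 : (0 : ℝ) < X := by linarith
  have hWcast : (W : ℝ) = ∏ p ∈ (Finset.range (q * ⌊X⌋₊ + 1)).filter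
      (fun p => p.Prime ∧ p ≠ 2 ∧ ¬ IsWieferich q p), (p : ℝ) := by
    rw [hW, Nat.cast_prod]
  rw [← hWcast]
  have h5 : (R : ℝ) ^ (1 - δ) * X < (4 * (q : ℝ) ^ 3 * W) * X := by
    rw [hsplit]; linarith
  exact lt_of_mul_lt_mul_right h5 hX0.le

/-- The same in logarithmic mass: at a `(1+δ)`-good scale `R ≥ 1` (`δ ≥ −1`),
`(1 − δ) log R < log (4q³) + Σ_{p ≤ q⌊R^{1+δ}⌋, p odd prime non-Wieferich to base q} log p`.
[cite: Silverman1988, Thm 1] -/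
theorem sparseGoodScales_log_lt_nonWieferich_mass_of_goodScale {q : ℕ} (hq : q.Prime) {δ : ℝ}
    (hδ : -1 ≤ δ) {R : ℕ} (hR : 1 ≤ R)
    (hgood : ∀ a b c : ℕ, IsABCTriple a b c → rad a b c ≤ R → (c : ℝ) ≤ (R : ℝ) ^ (1 + δ)) :
    (1 - δ) * Real.log R < Real.log (4 * (q : ℝ) ^ 3) +
      ∑ p ∈ (Finset.range (q * ⌊(R : ℝ) ^ (1 + δ)⌋₊ + 1)).filter
        (fun p => p.Prime ∧ p ≠ 2 ∧ ¬ IsWieferich q p), Real.log p := by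
  have hR0 : (0 : ℝ) < R := by exact_mod_cast hR
  have h := sparseGoodScales_rpow_lt_nonWieferich_prod_of_goodScale hq hδ hR hgood
  set S := (Finset.range (q * ⌊(R : ℝ) ^ (1 + δ)⌋₊ + 1)).filter
    (fun p => p.Prime ∧ p ≠ 2 ∧ ¬ IsWieferich q p) with hS
  have hSpos : ∀ p ∈ S, (0 : ℝ) < p := fun p hp =>
    by exact_mod_cast (Finset.mem_filter.mp hp).2.1.pos
  have hprod : (0 : ℝ) < ∏ p ∈ S, (p : ℝ) := Finset.prod_pos hSpos
  have hq0 : (0 : ℝ) < 4 * (q : ℝ) ^ 3 := by have := hq.pos; positivity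
  have hlog := Real.log_lt_log (Real.rpow_pos_of_pos hR0 _) h
  rw [Real.log_rpow hR0, Real.log_mul hq0.ne' hprod.ne',
    Real.log_prod (fun p hp => (hSpos p hp).ne')] at hlog
  exact hlog

/-- **The crux forces non-Wieferich mass at infinitely many scales.**  `SparseGoodScales` implies:
for every prime `q`, every `δ > 0` and every `N` there is a scale `R ≥ N` with
`(1 − δ) log R < log (4q³) + Σ_{p ≤ q⌊R^{1+δ}⌋, p odd non-Wieferich to base q} log p`.  (For `δ < 1`
the left side is unbounded, which re-proves the qualitative floor
`sparseGoodScales_imp_infinite_not_isWieferich`, p99695.) [cite: Silverman1988, Thm 1] -/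
theorem sparseGoodScales_imp_nonWieferich_mass :
    Summit.ABC.ABC.Theses.FeketeScales.SparseGoodScales → ∀ q : ℕ, q.Prime → ∀ δ : ℝ, 0 < δ →
      ∀ N : ℕ, ∃ R : ℕ, N ≤ R ∧ (1 - δ) * Real.log R < Real.log (4 * (q : ℝ) ^ 3) +
        ∑ p ∈ (Finset.range (q * ⌊(R : ℝ) ^ (1 + δ)⌋₊ + 1)).filter
          (fun p => p.Prime ∧ p ≠ 2 ∧ ¬ Literature.NumberTheory.DiophantineGeometry.IsWieferich q p),
            Real.log p := by
  intro h q hq δ hδ N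
  obtain ⟨R, hNR, hgood⟩ := h δ hδ (max N 1)
  exact ⟨R, le_trans (le_max_left _ _) hNR,
    sparseGoodScales_log_lt_nonWieferich_mass_of_goodScale hq (by linarith)
      (le_trans (le_max_right _ _) hNR) hgood⟩

end Summit.ABC.ABC.Theorems
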